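import Summits.NavierStokesRegularity.FluidComputer.PalasekTowerGermPushedAnchor

/-!
# The germ host, IV-b: the PUSHED germ host — host preparation under the WEAK (non-strict) anchor test

Cell `ns-blowup`, seat `ns-blowup-ecbridge-4` (g3); GROUP C «BRIDGE SUPPORT» of the route
`PalasekTowerBreakdown` (crux `EpisodeBaseG`, item stmt-NavierStokesRegularity-19179). Sequel of
`PalasekTowerGermPushedAnchor.lean` (pushed profiles, pushed line anchor) over ecbridge-3's germ series
(reused UNCHANGED). LABEL: E–C typing (KERNEL construction: one design slot, the prescribed level-`0`
host of every design filling it). WHAT THIS IS NOT: not Navier–Stokes evidence — the host is a PRESCRIBED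
flow whose force is its own NS residual (free before the readout, `≤ c₄ Y₀` on the first window, zero
from `τ₁`); nothing is said about the flow after `τ₀`, `FirstEpisodeD`, `EpisodeBaseG` or blow-up.

* §3 the residual of the pushed germ at `τ₀` is the push `κ • U`; the small-force window after `τ₀`;
* §4 the slot `LevelZeroDataWeak U ρ` (= `LevelZeroData` with `0 ≤ ⟪U, V⟫` on the argmax instead of
  `0 < ⟪U, V⟫`; `LevelZeroData.weak`) and, for every `c₄ ∈ (0, 1]`, the PUSHED GERM SCHEDULE (box
  schedule, zero datum, radius `ρ`, force = faded residual, push `κ = c₄/2`) — pinned (`Λ = 8`,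
  `θ = 6/5`), rigid, quiet — with its globally anchored registered LEVEL-`0` stage whose velocity at
  `τ₀` IS `U` (`LevelZeroDataWeak.stage`, `hostPreparationD_exact`, `exists_host`). The tiny-blob hosts
  of the negative lane (`TinyAnchoredHosts`, `PalasekTowerRegisterGlobalSmallData.lean`) are instances.

References: S. Palasek, arXiv:2605.13827 §3.3 (host preparation before the first readout)
[cite: Palasek2026ElementaryModel, §3.3]; A. J. Majda, A. L. Bertozzi, *Vorticity and Incompressible
Flow* (CUP 2002), §1.8 Prop. 1.16 [cite: MajdaBertozziCUP2002, §1.8 Prop. 1.16]; C. L. Fefferman, Clay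
problem description, (4)–(7) [cite: FeffermanClay2006, (4) (5) (6) (7)].
-/

noncomputable section

namespace Summit.NavierStokesRegularity.FluidComputer.PalasekTowerClayBridge.Germ

open Set Function Filter Topology InnerProductSpace Metric MeasureTheory
open scoped Topology ContDiff RealInnerProductSpace ENNReal

open Literature.Analysis.FluidPDE

/-! ## §3 The residual of the pushed germ at the readout, and the small-force window -/

section Resid

variable {ν : ℝ} {U : EuclideanSpace ℝ (Fin 3) → EuclideanSpace ℝ (Fin 3)} {α β : ℝ → ℝ}
variable (hU : ContDiff ℝ ∞ U) (hUc : HasCompactSupport U)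
include hU hUc

/-- **THE RESIDUAL AT THE PUSHED INSTANT IS THE PUSH**: if `α(τ₀) = 1`, `α'(τ₀) = κ`, `β(τ₀) = 0`,
`β'(τ₀) = 1` then `germResid τ₀ = κ • U` (the matched part `V + (U·∇)U − νΔU + ∇π` vanishes by the
Helmholtz decomposition of the drift). [cite: MajdaBertozziCUP2002, §1.8 Prop. 1.16 (1.91)] -/
theorem germResid_eq_smul_of_pushed {τ₀ κ : ℝ} (hα0 : α τ₀ = 1) (hα1 : deriv α τ₀ = κ)
    (hβ0 : β τ₀ = 0) (hβ1 : deriv β τ₀ = 1) (x : EuclideanSpace ℝ (Fin 3)) :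
    germResid ν U α β τ₀ x = κ • U x := by
  rw [germResid_eq hU hUc, hα0, hα1, hβ0, hβ1, accel_apply ν x, drift]
  simp only [one_pow, one_smul, mul_zero, zero_smul, add_zero, zero_pow two_ne_zero, sub_zero]
  module

variable (hα : ContDiff ℝ ∞ α) (hβ : ContDiff ℝ ∞ β)
include hα hβ

/-- **THE SMALL-FORCE WINDOW OF THE PUSHED GERM**: if at `τ₀` the residual is `≤ δ/2` everywhere and the
profile sits in `B̄(0, R)`, then for some `ε > 0` the residual is `≤ δ` on `[τ₀, τ₀ + ε] × ℝ³`
(uniform continuity on the compact `[τ₀, τ₀+1] × B̄(0, R)`; outside the ball it vanishes). [cite: FeffermanClay2006, (1)] -/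
theorem exists_window_norm_germResid_le_of_le {τ₀ R : ℝ} (hR : tsupport U ⊆ Metric.closedBall 0 R)
    {δ : ℝ} (hδ : 0 < δ) (h0 : ∀ x, ‖germResid ν U α β τ₀ x‖ ≤ δ / 2) :
    ∃ ε : ℝ, 0 < ε ∧ ∀ t ∈ Icc τ₀ (τ₀ + ε), ∀ x : EuclideanSpace ℝ (Fin 3),
      ‖germResid ν U α β t x‖ ≤ δ := by
  set F := uncurry (germResid ν U α β) with hF
  have hFc : Continuous F := continuous_uncurry_germResid hU hUc hα hβ
  set K : Set (ℝ × EuclideanSpace ℝ (Fin 3)) := Icc τ₀ (τ₀ + 1) ×ˢ Metric.closedBall 0 R with hK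
  have hKc : IsCompact K := isCompact_Icc.prod (isCompact_closedBall 0 R)
  have hUC : UniformContinuousOn F K := hKc.uniformContinuousOn_of_continuous hFc.continuousOn
  obtain ⟨η, hη, hηF⟩ := Metric.uniformContinuousOn_iff.1 hUC (δ / 2) (by positivity)
  refine ⟨min 1 (η / 2), by positivity, fun t ht x => ?_⟩
  have ht1 : t ≤ τ₀ + 1 := ht.2.trans (by linarith [min_le_left (1 : ℝ) (η / 2)])
  have htη : t - τ₀ < η := by
    have hmin : min 1 (η / 2) ≤ η / 2 := min_le_right _ _
    linarith [ht.2]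
  by_cases hx : ‖x‖ ≤ R
  · have hp : (t, x) ∈ K := ⟨⟨ht.1, ht1⟩, by simpa [Metric.mem_closedBall, dist_zero_right] using hx⟩
    have hq : (τ₀, x) ∈ K :=
      ⟨⟨le_rfl, by linarith⟩, by simpa [Metric.mem_closedBall, dist_zero_right] using hx⟩
    have hdist : dist (t, x) (τ₀, x) < η := by
      rw [Prod.dist_eq, dist_self, max_eq_left dist_nonneg, Real.dist_eq,
        abs_of_nonneg (by linarith [ht.1])]
      exact htη
    have h := hηF (t, x) hp (τ₀, x) hq hdist
    rw [dist_eq_norm] at h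
    have htri : ‖F (t, x)‖ ≤ ‖F (τ₀, x)‖ + ‖F (t, x) - F (τ₀, x)‖ := by
      have := norm_add_le (F (τ₀, x)) (F (t, x) - F (τ₀, x))
      rwa [add_sub_cancel] at this
    have h0' : ‖F (τ₀, x)‖ ≤ δ / 2 := h0 x
    simp only [hF, uncurry_apply_pair] at htri h h0' ⊢
    linarith
  · rw [germResid_eq_zero_of_norm_gt hU hUc hR t (not_le.1 hx), norm_zero]
    exact hδ.le

end Resid

/-! ## §4 The weak design slot and the pushed germ host -/

/-- **LEVEL-`0` DATA OF A NAMED PROFILE, WEAK FORM**: as `LevelZeroData` (smooth, divergence free,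
supported in `B̄(0, ρ)`; speed `≤ Y₀` everywhere, `= Y₀` somewhere in the ball; strain `≥ A₀` in the ball;
an `N₀`-core loop in the ball with circulation `≥ N₀^{β−2}`) but with the WEAK first-order anchor test
`⟪U, P(ΔU − (U·∇)U)⟫ ≥ 0` on the argmax of `‖U‖` — the push of the register pays for the rise.
[cite: Palasek2026ElementaryModel, §3.3] -/
structure LevelZeroDataWeak (U : EuclideanSpace ℝ (Fin 3) → EuclideanSpace ℝ (Fin 3)) (ρ : ℝ) : Prop where
  /-- the profile is smooth -/
  smooth : ContDiff ℝ ∞ U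
  /-- … supported in the closed ball of radius `ρ` -/
  support : tsupport U ⊆ closedBall 0 ρ
  /-- … and divergence free -/
  divFree : VectorCalculus.IsDivFree U
  /-- speed ceiling `Y₀` everywhere -/
  ceiling : ∀ x, ‖U x‖ ≤ TowerRates.wide.Y 0
  /-- speed floor `Y₀` attained in the ball -/
  floor : ∃ x, ‖x‖ ≤ ρ ∧ TowerRates.wide.Y 0 ≤ ‖U x‖
  /-- strain floor `A₀` attained in the ball -/
  strain : ∃ x, ‖x‖ ≤ ρ ∧ TowerRates.wide.A 0 ≤ ‖fderiv ℝ U x‖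
  /-- the level-`0` core loop -/
  core : ∃ (x : EuclideanSpace ℝ (Fin 3)) (γ : ℝ → EuclideanSpace ℝ (Fin 3)),
    ‖x‖ ≤ ρ ∧ ContDiff ℝ 1 γ ∧ γ 0 = γ 1 ∧
      (∀ s ∈ Icc (0 : ℝ) 1, γ s ∈ closedBall x (1 / TowerRates.wide.N 0)) ∧
      (∀ s ∈ Icc (0 : ℝ) 1, ‖deriv γ s‖ ≤ 8 * Real.pi / TowerRates.wide.N 0) ∧
      TowerRates.wide.N 0 ^ (TowerRates.wide.β - 2) ≤ circulation U γ
  /-- the WEAK first-order anchor test at the speed maximum -/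
  anchor : ∀ x, ‖U x‖ = TowerRates.wide.Y 0 → 0 ≤ ⟪U x, accel 1 U x⟫

/-- The strict slot implies the weak one. [folklore] -/
theorem LevelZeroData.weak {U : EuclideanSpace ℝ (Fin 3) → EuclideanSpace ℝ (Fin 3)} {ρ : ℝ}
    (h : LevelZeroData U ρ) : LevelZeroDataWeak U ρ :=
  ⟨h.smooth, h.support, h.divFree, h.ceiling, h.floor, h.strain, h.core,
    fun x hx => (h.anchor x hx).le⟩

namespace LevelZeroDataWeak

variable {U : EuclideanSpace ℝ (Fin 3) → EuclideanSpace ℝ (Fin 3)} {ρ : ℝ} (h : LevelZeroDataWeak U ρ)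
include h

/-- The profile's support is compact (stated on `tsupport`; as `HasCompactSupport U` this is the
`LevelZeroData` lemma of GermHost, III). [folklore] -/
theorem isCompact_tsupport : IsCompact (tsupport U) :=
  (isCompact_closedBall (0 : EuclideanSpace ℝ (Fin 3)) ρ).of_isClosed_subset (isClosed_tsupport U)
    h.support

section Push

variable {c₄ : ℝ} (hc₄ : 0 < c₄) (hc₄' : c₄ ≤ 1)
include hc₄

/-- The pushed anchor width exists for the push `κ = c₄/2`. [folklore] -/
theorem exists_width : ∃ s₀ : ℝ, 0 < s₀ ∧ s₀ ≤ 1 / 2 ∧ c₄ / 2 * s₀ ≤ 1 ∧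
    ∀ s : ℝ, 0 < s → s ≤ s₀ → ∀ σ : ℝ, -s ≤ σ → σ ≤ 0 →
      ∀ x, (1 - c₄ / 2 * s) * ‖U x + σ • accel 1 U x‖ < TowerRates.wide.Y 0 :=
  exists_pushed_line_anchor h.smooth h.isCompact_tsupport Host.wide_Y_zero_pos (by positivity)
    h.ceiling h.anchor

/-- **The width `s₀`** for the push constant `c₄` (a choice; used as anchor scale AND line width). [folklore] -/
def width : ℝ := (h.exists_width hc₄).choose

/-- `0 < s₀`. [folklore] -/
theorem width_pos : 0 < h.width hc₄ := (h.exists_width hc₄).choose_spec.1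

/-- `s₀ ≤ 1/2`. [folklore] -/
theorem width_le_half : h.width hc₄ ≤ 1 / 2 := (h.exists_width hc₄).choose_spec.2.1

/-- The pushed line anchor at width `s₀`. [folklore] -/
theorem width_anchor : ∀ s : ℝ, 0 < s → s ≤ h.width hc₄ → ∀ σ : ℝ, -s ≤ σ → σ ≤ 0 →
    ∀ x, (1 - c₄ / 2 * s) * ‖U x + σ • accel 1 U x‖ < TowerRates.wide.Y 0 :=
  (h.exists_width hc₄).choose_spec.2.2.2

/-- **The velocity of the pushed germ host**: `αpush (c₄/2) t • (U + σline s₀ t • V)`. [folklore] -/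
def vel : ℝ → EuclideanSpace ℝ (Fin 3) → EuclideanSpace ℝ (Fin 3) :=
  germ 1 U (αpush (c₄ / 2)) (βpush (c₄ / 2) (h.width hc₄))

/-- **The pressure of the pushed germ host**. [folklore] -/
def pres : ℝ → EuclideanSpace ℝ (Fin 3) → ℝ := germPres 1 U (βpush (c₄ / 2) (h.width hc₄))

/-- **`u(τ₀) = U`**. [folklore] -/
theorem vel_one : h.vel hc₄ 1 = U := germ_pushed_one 1 U _ _

/-- The host starts from rest. [folklore] -/
theorem vel_zero : h.vel hc₄ 0 = 0 := germ_pushed_zero 1 U _ _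

/-- **THE RESIDUAL AT THE READOUT IS THE PUSH `(c₄/2) • U`.** [folklore] -/
theorem germResid_one (x : EuclideanSpace ℝ (Fin 3)) :
    germResid 1 U (αpush (c₄ / 2)) (βpush (c₄ / 2) (h.width hc₄)) 1 x = (c₄ / 2) • U x :=
  germResid_eq_smul_of_pushed h.smooth h.isCompact_tsupport (αpush_one _) (deriv_αpush_one _)
    (βpush_one _ _) (deriv_βpush_one _ (h.width_pos hc₄).ne') x

/-- The fade length exists: after `τ₀ = 1` the residual stays `≤ c₄ Y₀` for a while (it is `(c₄/2) • U`,
of norm `≤ c₄Y₀/2`, at `τ₀`), and we may take that while `≤ w₀`. [folklore] -/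
theorem exists_fadeLen : ∃ ε : ℝ, 0 < ε ∧ ε ≤ Host.wfirst ∧
    ∀ t ∈ Icc (1 : ℝ) (1 + ε), ∀ x : EuclideanSpace ℝ (Fin 3),
      ‖germResid 1 U (αpush (c₄ / 2)) (βpush (c₄ / 2) (h.width hc₄)) t x‖ ≤
        c₄ * TowerRates.wide.Y 0 := by
  have hY := Host.wide_Y_zero_pos
  have hδ : 0 < c₄ * TowerRates.wide.Y 0 := mul_pos hc₄ hY
  have h0 : ∀ x, ‖germResid 1 U (αpush (c₄ / 2)) (βpush (c₄ / 2) (h.width hc₄)) 1 x‖ ≤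
      c₄ * TowerRates.wide.Y 0 / 2 := by
    intro x
    rw [h.germResid_one hc₄ x, norm_smul, Real.norm_eq_abs, abs_of_pos (by positivity)]
    have := h.ceiling x
    nlinarith
  obtain ⟨ε, hε, hwin⟩ := exists_window_norm_germResid_le_of_le (ν := 1) h.smooth h.isCompact_tsupport
    (contDiff_αpush _) (contDiff_βpush _ _) h.support hδ h0
  refine ⟨min ε Host.wfirst, lt_min hε Host.wfirst_pos, min_le_right _ _, fun t ht x => ?_⟩
  exact hwin t ⟨ht.1, ht.2.trans (by linarith [min_le_left ε Host.wfirst])⟩ x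

/-- **The fade length `ε`** (a choice). [folklore] -/
def fadeLen : ℝ := (h.exists_fadeLen hc₄).choose

/-- `0 < ε`. [folklore] -/
theorem fadeLen_pos : 0 < h.fadeLen hc₄ := (h.exists_fadeLen hc₄).choose_spec.1

/-- `ε ≤ w₀`. [folklore] -/
theorem fadeLen_le_wfirst : h.fadeLen hc₄ ≤ Host.wfirst := (h.exists_fadeLen hc₄).choose_spec.2.1

/-- The residual is `≤ c₄ Y₀` on `[1, 1 + ε] × ℝ³`. [folklore] -/
theorem fadeLen_window : ∀ t ∈ Icc (1 : ℝ) (1 + h.fadeLen hc₄), ∀ x : EuclideanSpace ℝ (Fin 3),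
    ‖germResid 1 U (αpush (c₄ / 2)) (βpush (c₄ / 2) (h.width hc₄)) t x‖ ≤
      c₄ * TowerRates.wide.Y 0 :=
  (h.exists_fadeLen hc₄).choose_spec.2.2

/-- **The force of the pushed germ host**: the residual, faded out on `[1, 1 + ε]`. [folklore] -/
def force : ℝ → EuclideanSpace ℝ (Fin 3) → EuclideanSpace ℝ (Fin 3) :=
  germForce 1 U (αpush (c₄ / 2)) (βpush (c₄ / 2) (h.width hc₄)) (1 + h.fadeLen hc₄)
    (h.fadeLen hc₄)

/-- The force is jointly smooth. [cite: FeffermanClay2006, (6)] -/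
theorem contDiff_uncurry_force : ContDiff ℝ ∞ (uncurry (h.force hc₄)) :=
  contDiff_uncurry_germForce h.smooth h.isCompact_tsupport (contDiff_αpush _) (contDiff_βpush _ _)

/-- The force has compact space-time support. [cite: FeffermanClay2006, (5)] -/
theorem hasCompactSupport_force : HasCompactSupport (uncurry (h.force hc₄)) :=
  hasCompactSupport_germForce h.smooth h.isCompact_tsupport (h.fadeLen_pos hc₄) h.support
    (fun _ ht => αpush_of_nonpos ht) (fun _ ht => βpush_of_nonpos ht)

/-- The force vanishes from `τ₁ = 1 + w₀` on. [folklore] -/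
theorem force_eq_zero_of_ge : ∀ t, Host.τfirst ≤ t → ∀ x, h.force hc₄ t x = 0 := by
  intro t ht x
  have h1 : 1 + h.fadeLen hc₄ ≤ t := by
    rw [Host.τfirst_eq] at ht
    linarith [h.fadeLen_le_wfirst hc₄]
  exact germForce_eq_zero_of_ge (h.fadeLen_pos hc₄) h1 x

/-- The window bound `‖force‖ ≤ c₄ Y₀` on `[1, τ₁]`. [folklore] -/
theorem norm_force_le :
    ∀ t ∈ Icc (1 : ℝ) Host.τfirst, ∀ x, ‖h.force hc₄ t x‖ ≤ c₄ * TowerRates.wide.Y 0 :=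
  fun _ ht x => norm_germForce_le_of_window (h.fadeLen_pos hc₄)
    (mul_pos hc₄ Host.wide_Y_zero_pos).le (h.fadeLen_window hc₄) ht.1 x

/-- The force is confined to the ball. [folklore] -/
theorem force_eq_zero_of_norm_gt (t : ℝ) (x : EuclideanSpace ℝ (Fin 3)) (hx : ρ < ‖x‖) :
    h.force hc₄ t x = 0 :=
  germForce_eq_zero_of_norm_gt h.smooth h.isCompact_tsupport h.support t hx

/-- On the slab `t ≤ 1` the force IS the residual. [folklore] -/
theorem force_eq_germResid {t : ℝ} (ht : t ≤ 1) (x : EuclideanSpace ℝ (Fin 3)) :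
    h.force hc₄ t x = germResid 1 U (αpush (c₄ / 2)) (βpush (c₄ / 2) (h.width hc₄)) t x :=
  germForce_eq_germResid (h.fadeLen_pos hc₄) (by linarith) x

/-- **THE PUSHED GERM SCHEDULE** for push constant `c₄ ∈ (0, 1]`: box schedule, zero datum, radius `ρ`.
[cite: Palasek2026ElementaryModel, §3.3] -/
def schedule : Schedule TowerRates.wide :=
  Schedule.ofBox 0 (h.force hc₄) ρ c₄ hc₄' contDiff_const HasCompactSupport.zero
    (h.contDiff_uncurry_force hc₄) (h.hasCompactSupport_force hc₄) (h.force_eq_zero_of_ge hc₄)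
    (h.norm_force_le hc₄)

/-- RIGID. [folklore] -/
theorem schedule_rigid : (h.schedule hc₄ hc₄').Rigid := Schedule.ofBox_rigid _ _ _ _ _ _ _

/-- QUIET. [folklore] -/
theorem schedule_quiet : (h.schedule hc₄ hc₄').Quiet := Schedule.ofBox_quiet _ _ _ _ _ _ _

/-- PINNED (`Λ = 8`, `θ = 6/5`). [folklore] -/
theorem schedule_pins : (h.schedule hc₄ hc₄').Pins 8 (6 / 5) :=
  Schedule.ofBox_pins _ _ _ _ _ _ _ (fun _ _ => rfl) (fun t x hx => h.force_eq_zero_of_norm_gt hc₄ t x hx)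

/-- `τ 0 = 1`. [folklore] -/
theorem schedule_τ_zero : (h.schedule hc₄ hc₄').τ 0 = 1 := Host.windowTime_zero

/-- `c₁ = 1`. [folklore] -/
theorem schedule_c₁ : (h.schedule hc₄ hc₄').c₁ = 1 := rfl

/-- `c₂ = 5/3`. [folklore] -/
theorem schedule_c₂ : (h.schedule hc₄ hc₄').c₂ = 5 / 3 := rfl

/-- **The pushed germ solves forced Navier–Stokes with the schedule's force on `[0, 1]`.**
[cite: FeffermanClay2006, (1) (2)] -/
theorem isClassicalNSSolutionOn_vel :
    IsClassicalNSSolutionOn (Icc 0 1) 1 (h.schedule hc₄ hc₄').f (h.vel hc₄) (h.pres hc₄) := by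
  have hb := isClassicalNSSolutionOn_germ (ν := 1) (α := αpush (c₄ / 2))
    (β := βpush (c₄ / 2) (h.width hc₄)) h.smooth h.isCompact_tsupport (contDiff_αpush _)
    (contDiff_βpush _ _) h.divFree one_pos
  refine ⟨hb.smooth_velocity, hb.smooth_pressure, fun t ht x => ?_, hb.divFree⟩
  have hf : (h.schedule hc₄ hc₄').f t x =
      germResid 1 U (αpush (c₄ / 2)) (βpush (c₄ / 2) (h.width hc₄)) t x :=
    h.force_eq_germResid hc₄ ht.2 x
  rw [hf]
  exact hb.momentum t ht x

/-- **THE GLOBAL ANCHOR**: `‖u(t, x)‖ < Y₀` for `t < 1`. [folklore] -/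
theorem norm_vel_lt (hc₄' : c₄ ≤ 1) {t : ℝ} (ht : t < 1) (x : EuclideanSpace ℝ (Fin 3)) :
    ‖h.vel hc₄ t x‖ < TowerRates.wide.Y 0 :=
  norm_germ_pushed_lt (by positivity) (by linarith) (h.width_pos hc₄) (h.width_le_half hc₄)
    (h.width_anchor hc₄) ht x

/-- The ceiling on the slab: `‖u(t, x)‖ ≤ Y₀` for `t ≤ 1`. [folklore] -/
theorem norm_vel_le (hc₄' : c₄ ≤ 1) {t : ℝ} (ht : t ≤ 1) (x : EuclideanSpace ℝ (Fin 3)) :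
    ‖h.vel hc₄ t x‖ ≤ TowerRates.wide.Y 0 :=
  norm_germ_pushed_le (by positivity) (by linarith) (h.width_pos hc₄) (h.width_le_half hc₄)
    h.ceiling (h.width_anchor hc₄) ht x

/-- Finite energy on the slab. [cite: FeffermanClay2006, (7)] -/
theorem energy_vel (hc₄' : c₄ ≤ 1) :
    ∃ C : ℝ≥0∞, C < ⊤ ∧ ∀ t ∈ Icc (0 : ℝ) 1, ∫⁻ x, ‖h.vel hc₄ t x‖ₑ ^ 2 ≤ C :=
  energy_germ (ν := 1) h.smooth h.isCompact_tsupport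
    (fun t ht => abs_αpush_le (by positivity) (by linarith) ht.2)
    (fun _ ht => abs_βpush_le (by positivity) (by linarith) (h.width_pos hc₄) ht.2)

/-- **THE LEVEL-`0` STAGE OF THE PUSHED GERM SCHEDULE** (floor / ceiling / strain / GLOBAL ANCHOR /
rigidity / core ledger, all read off `U = u(τ₀)`), packaged with the identity `u(τ₀) = U`.
[cite: Palasek2026ElementaryModel, §3.3] -/
theorem stage : ∃ s : Stage 1 TowerRates.wide (h.schedule hc₄ hc₄') (Margins.routeG TowerRates.wide) 0,
    s.u ((h.schedule hc₄ hc₄').τ 0) = U := by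
  have hτ0 : (h.schedule hc₄ hc₄').τ 0 = 1 := h.schedule_τ_zero hc₄ hc₄'
  have hY := Host.wide_Y_zero_pos
  have henergy : ∃ C : ℝ≥0∞, C < ⊤ ∧ ∀ t ∈ Icc 0 ((h.schedule hc₄ hc₄').τ 0),
      ∫⁻ x, ‖h.vel hc₄ t x‖ₑ ^ 2 ≤ C := by
    rw [hτ0]; exact h.energy_vel hc₄ hc₄'
  have hcl : IsClassicalNSSolutionOn (Icc 0 ((h.schedule hc₄ hc₄').τ 0)) 1
      (h.schedule hc₄ hc₄').f (h.vel hc₄) (h.pres hc₄) := by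
    rw [hτ0]; exact h.isClassicalNSSolutionOn_vel hc₄ hc₄'
  refine ⟨{ u := h.vel hc₄, p := h.pres hc₄, classical := hcl, initial := ?_, energy := henergy,
            floor := ?_, ceiling := ?_, quiet := ?_, margin := ?_ }, ?_⟩
  · rw [h.vel_zero]; rfl
  · intro j hj
    obtain rfl := Nat.le_zero.1 hj
    obtain ⟨x, hx, hfl⟩ := h.floor
    refine ⟨x, hx, ?_⟩
    rw [hτ0, schedule_c₁, one_mul, h.vel_one]
    exact hfl
  · intro j hj t ht x
    obtain rfl := Nat.le_zero.1 hj
    rw [hτ0] at ht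
    rw [schedule_c₂]
    have := h.norm_vel_le hc₄ hc₄' ht.2 x
    linarith
  · intro j hj
    exact absurd hj (by omega)
  · show (∀ j, j ≤ 0 → ∃ x, ‖x‖ ≤ (h.schedule hc₄ hc₄').radius ∧
        (h.schedule hc₄ hc₄').c₁ * TowerRates.wide.A j ≤
          ‖fderiv ℝ (h.vel hc₄ ((h.schedule hc₄ hc₄').τ j)) x‖) ∧
      ((h.schedule hc₄ hc₄').AnchorGlobal (h.vel hc₄) ∧
        ((h.schedule hc₄ hc₄').Rigid ∧
          CoreLedger TowerRates.wide (h.schedule hc₄ hc₄') 0 (h.vel hc₄)))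
    refine ⟨?_, ?_, h.schedule_rigid hc₄ hc₄', ?_⟩
    · intro j hj
      obtain rfl := Nat.le_zero.1 hj
      obtain ⟨x, hx, hst⟩ := h.strain
      refine ⟨x, hx, ?_⟩
      rw [hτ0, schedule_c₁, one_mul, h.vel_one]
      exact hst
    · intro t ht x
      rw [hτ0] at ht
      rw [schedule_c₁, one_mul]
      exact h.norm_vel_lt hc₄ hc₄' ht.2 x
    · intro j hj
      obtain rfl := Nat.le_zero.1 hj
      obtain ⟨x, γ, hx, hγ, hcl', hball, hspeed, hcirc⟩ := h.core
      refine ⟨x, γ, hx, hγ, hcl', hball, hspeed, ?_⟩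
      rw [hτ0, schedule_c₁, one_mul, h.vel_one]
      exact hcirc
  · show h.vel hc₄ ((h.schedule hc₄ hc₄').τ 0) = U
    rw [hτ0, h.vel_one]

/-- **HOST PREPARATION IN THE SINGLETON CLASS OF THE PUSHED GERM SCHEDULE** — for EVERY named profile
filling the weak slot and every push constant `c₄ ∈ (0, 1]`. [cite: Palasek2026ElementaryModel, §3.3] -/
theorem hostPreparationD_exact : HostPreparationD (HostClass.exact (h.schedule hc₄ hc₄')) := by
  obtain ⟨s, -⟩ := h.stage hc₄ hc₄'
  exact (hostPreparationD_exact_iff _).2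
    ⟨h.schedule_pins hc₄ hc₄', h.schedule_rigid hc₄ hc₄', h.schedule_quiet hc₄ hc₄', ⟨s⟩⟩

end Push

/-- **THE HOST OF A WEAK-SLOT PROFILE, packaged for the register**: a pinned (`Λ = 8`, `θ = 6/5`), rigid,
quiet schedule on the wide rates with ball radius EXACTLY `ρ` and push constant `c₄ = 1`, carrying a
registered globally anchored LEVEL-`0` stage at unit viscosity whose readout slice IS the profile `U`.
[cite: Palasek2026ElementaryModel, §3.3] -/
theorem exists_host : ∃ S : Schedule TowerRates.wide, S.Pins 8 (6 / 5) ∧ S.Rigid ∧ S.Quiet ∧ S.radius = ρ ∧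
    ∃ s : Stage 1 TowerRates.wide S (Margins.routeG TowerRates.wide) 0, s.u (S.τ 0) = U := by
  obtain ⟨s, hs⟩ := h.stage one_pos le_rfl
  exact ⟨h.schedule one_pos le_rfl, h.schedule_pins one_pos le_rfl, h.schedule_rigid one_pos le_rfl,
    h.schedule_quiet one_pos le_rfl, rfl, s, hs⟩

end LevelZeroDataWeak

end Summit.NavierStokesRegularity.FluidComputer.PalasekTowerClayBridge.Germ

end
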